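import Literature.NumberTheory.LFunctions.XiHeatRayMonotone
import Literature.NumberTheory.LFunctions.DeBruijnNewmanConstProofs
import HarnessLib

/-!
# RiemannHypothesis / DBN — RH-FREE lemma K1: far zeros of `H_t` are real, uniformly on `t ≥ t₁ > 0`

LINE 1 — LABEL: **RH-FREE** (an explicit, `t`-monotone form of the reality part of Ki–Kim–Lee
2009, Thm. 1.3, re-exposed from the tree's in-kernel proof; no ζ-zero input beyond the critical
strip, no statement about `Λ`).  bears_on: N-C/N-P (LADDER-RH §1, COLUMN 3 DBN; lemma K1 of
`rh-crit/rt/RESIDUAL.md` §3, feeding the RH-FREE leaf K2 `DbnTheory.CoalescenceAtLambda`).  WHAT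
THIS IS NOT: the threshold `4π·e^{80/t}` blows up as `t ↓ 0` — this is NOT a `t`-uniform zero-free
region reaching `t → 0⁺` (that would be RH-strength, `DBN.DbnHighUniform`); nothing here bears on
the truth of RH.

* `im_eq_zero_of_zero_of_exp_le_abs_re` — for `0 < t < 1/2`, every zero `z` of
  `H_t = Literature.NumberTheory.LFunctions.deBruijnH t` with `|Re z| ≥ 4π·e^{80/t}` is real.  This
  is the `key` step inside the tree's `ki_kim_lee_finite_of_strictMonoOn_xiHeatRay` (Hermite–Biehler:
  a zero `z = x + iy`, `|y| < 1`, gives `‖𝒜_t((1−y)/2 + ix/2)‖ = ‖𝒜_t((1+y)/2 + ix/2)‖`, while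
  `σ ↦ ‖𝒜_t(σ + iT)‖` is strictly monotone on `[0,1]` for `T ≥ 2π·e^{80/t}` —
  `strictMonoOn_norm_xiHeatRay_of_le`, Laplace's method on the heat ray), with the threshold made
  EXPLICIT instead of hidden behind `∃ T`.
* `im_eq_zero_of_zero_uniform` — for `0 < t₁ ≤ t` (`t₁ < 1/2`) the single threshold
  `4π·e^{80/t₁}` works for all such `t` (monotonicity of the threshold in `t`; for `t ≥ 1/2` all
  zeros are real since `Λ ≤ 1/2`, `hasOnlyRealZeros_deBruijnH_one_half_holds`).
* `exists_uniform_far_zeros_real` — packaged: `∀ t₁ > 0, ∃ X, ∀ t ≥ t₁, zeros of H_t with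
  |Re z| ≥ X are real`.

`--supports stmt-RiemannHypothesis-0274` (route DBN target X); closes nothing.  Theorems only.

References: H. Ki, Y.-O. Kim, J. Lee, Adv. Math. 222 (2009) 281–306, Thm. 1.3;
D. H. J. Polymath, Res. Math. Sci. 6 (2019) 31 = arXiv:1904.12438, §4 eq. (30), Thm. 1.5 (i).
-/

noncomputable section

-- D-0017: `Summit.<S>.<S>.…` is the designed namespace of a single-problem summit.
set_option linter.dupNamespace false

namespace Summit.RiemannHypothesis.RiemannHypothesis.Theorems.DbnTheory

open Literature.NumberTheory.LFunctions
open Complex Set Real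

/-- **K1, explicit threshold.**  For `0 < t < 1/2`, every zero `z` of `H_t` with
`4π·e^{80/t} ≤ |Re z|` is real (Ki–Kim–Lee 2009 Thm. 1.3, reality part, in the explicit form the
tree's proof yields: Hermite–Biehler step of `ki_kim_lee_finite_of_strictMonoOn_xiHeatRay` with the
threshold `T ≥ 2π·e^{80/t}` of `strictMonoOn_norm_xiHeatRay_of_le`, `T = |Re z|/2`).
[cite: KiKimLee2009, Thm. 1.3] -/
theorem im_eq_zero_of_zero_of_exp_le_abs_re {t : ℝ} (ht0 : 0 < t) (ht : t < 1 / 2) {z : ℂ}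
    (hz : deBruijnH t z = 0) (hre : 4 * π * Real.exp (80 / t) ≤ |z.re|) : z.im = 0 := by
  -- zeros with large positive real part are real
  have key : ∀ w : ℂ, deBruijnH t w = 0 → 4 * π * Real.exp (80 / t) ≤ w.re → w.im = 0 := by
    intro w hw hwre
    set x : ℝ := w.re with hx
    set y : ℝ := w.im with hy
    have hy1 : |y| < 1 := Polymath15.abs_im_lt_one_of_zero ht0.le hw
    have hmono := strictMonoOn_norm_xiHeatRay_of_le ht0 ht (T := x / 2) (by linarith)
    set s : ℂ := (1 + I * w) / 2 with hs
    have hs' : s = (((1 - y) / 2 : ℝ) : ℂ) + (x / 2 : ℝ) * I := by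
      rw [hs, ← re_add_im w]
      simp only [← hx, ← hy]
      push_cast
      ring_nf
      rw [Complex.I_sq]
      ring
    have h1s : 1 - s = (starRingEnd ℂ) ((((1 + y) / 2 : ℝ) : ℂ) + (x / 2 : ℝ) * I) := by
      rw [hs', map_add, Complex.conj_ofReal, map_mul, Complex.conj_ofReal, Complex.conj_I]
      push_cast
      ring
    have hrep := deBruijnH_eq_xiHeatRay_add ht0 w
    rw [hw] at hrep
    have hc : ((1 / (8 * Real.sqrt (Real.pi * t)) : ℝ) : ℂ) ≠ 0 := by
      have : 0 < Real.sqrt (Real.pi * t) := Real.sqrt_pos.2 (by positivity)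
      exact_mod_cast (by positivity : (1 / (8 * Real.sqrt (Real.pi * t)) : ℝ) ≠ 0)
    have hsum : xiHeatRay t s + xiHeatRay t (1 - s) = 0 := by
      rcases mul_eq_zero.1 hrep.symm with h0 | h0
      · exact absurd h0 hc
      · exact h0
    have hnorm : ‖xiHeatRay t ((((1 - y) / 2 : ℝ) : ℂ) + (x / 2 : ℝ) * I)‖ =
        ‖xiHeatRay t ((((1 + y) / 2 : ℝ) : ℂ) + (x / 2 : ℝ) * I)‖ := by
      rw [← hs', show xiHeatRay t s = -xiHeatRay t (1 - s) from eq_neg_of_add_eq_zero_left hsum,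
        norm_neg, h1s, xiHeatRay_conj, Complex.norm_conj]
    have ha : (1 - y) / 2 ∈ Icc (0 : ℝ) 1 := by
      constructor <;> linarith [(abs_lt.1 hy1).1, (abs_lt.1 hy1).2]
    have hb : (1 + y) / 2 ∈ Icc (0 : ℝ) 1 := by
      constructor <;> linarith [(abs_lt.1 hy1).1, (abs_lt.1 hy1).2]
    have heq := hmono.injOn ha hb hnorm
    linarith
  rcases le_or_gt 0 z.re with h0 | h0
  · exact key z hz (by rwa [abs_of_nonneg h0] at hre)
  · have hneg : deBruijnH t (-z) = 0 := by rw [deBruijnH_neg, hz]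
    have := key (-z) hneg (by rw [neg_re]; rwa [abs_of_neg h0] at hre)
    simpa using this

/-- **K1, uniform on `t ≥ t₁`.**  If `0 < t₁ < 1/2` and `t₁ ≤ t`, every zero of `H_t` with
`4π·e^{80/t₁} ≤ |Re z|` is real: the threshold `4π·e^{80/t}` is decreasing in `t`, and for
`t ≥ 1/2` all zeros of `H_t` are real (`Λ ≤ 1/2`, de Bruijn 1950). [cite: KiKimLee2009, Thm. 1.3] -/
theorem im_eq_zero_of_zero_uniform {t₁ : ℝ} (ht₁ : 0 < t₁) (ht₁' : t₁ < 1 / 2) {t : ℝ}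
    (ht : t₁ ≤ t) {z : ℂ} (hz : deBruijnH t z = 0) (hre : 4 * π * Real.exp (80 / t₁) ≤ |z.re|) :
    z.im = 0 := by
  rcases lt_or_ge t (1 / 2) with hlt | hge
  · have ht0 : 0 < t := lt_of_lt_of_le ht₁ ht
    refine im_eq_zero_of_zero_of_exp_le_abs_re ht0 hlt hz (le_trans ?_ hre)
    have hexp : Real.exp (80 / t) ≤ Real.exp (80 / t₁) :=
      Real.exp_le_exp.2 (div_le_div_of_nonneg_left (by norm_num) ht₁ ht)
    have hπ := Real.pi_pos
    nlinarith
  · exact HasOnlyRealZeros.mono_deBruijnH_holds hge hasOnlyRealZeros_deBruijnH_one_half_holds z hz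

/-- **K1, packaged.**  For every `t₁ > 0` there is one threshold `X` such that for all `t ≥ t₁`
every zero of `H_t` with `X ≤ |Re z|` is real (`X = 4π·e^{80/t₁}` if `t₁ < 1/2`, else `X = 0`).
[cite: KiKimLee2009, Thm. 1.3] -/
theorem exists_uniform_far_zeros_real {t₁ : ℝ} (ht₁ : 0 < t₁) :
    ∃ X : ℝ, ∀ t : ℝ, t₁ ≤ t → ∀ z : ℂ, deBruijnH t z = 0 → X ≤ |z.re| → z.im = 0 := by
  rcases lt_or_ge t₁ (1 / 2) with hlt | hge
  · exact ⟨4 * π * Real.exp (80 / t₁), fun t ht z hz hre ↦ im_eq_zero_of_zero_uniform ht₁ hlt ht hz hre⟩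
  · refine ⟨0, fun t ht z hz _ ↦ ?_⟩
    exact HasOnlyRealZeros.mono_deBruijnH_holds (hge.trans ht)
      hasOnlyRealZeros_deBruijnH_one_half_holds z hz

end Summit.RiemannHypothesis.RiemannHypothesis.Theorems.DbnTheory

end
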